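import Summits.NavierStokesRegularity.FluidComputer.PalasekTowerRingPusher
import Summits.NavierStokesRegularity.FluidComputer.PalasekTowerGermHostDipoleCone

/-!
# The ring pusher, II: the strict-anchor INTEGRAND of the coaxial ring pusher as an explicit density, and its
# pointwise sum-of-squares lower envelope on the shell (first half of the sign computation for stub D2)

Cell `ns-blowup`, seat `ns-blowup-fc-prover-2` (g11; D-0074 GROUP C «BRIDGE SUPPORT»). Route `PalasekTowerBreakdown`
(rev 19), crux stmt-NavierStokesRegularity-20303 `EpisodeBaseT` / heredity pair 20304 · 20305, strategist's line `doormirror`,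
stub D2 `SterileMechanismDoorT`. Sequel of `PalasekTowerRingPusher` (`ringPusher δ = curl (Φ_δ • J)`). LABEL: E–C typing + kernel
analysis (four auxiliary definitions with body — two constants, the explicit integrand `ringDensity`, its lower envelope
`ringEnvelope` — and theorems). WHAT THIS IS NOT: not Navier–Stokes evidence — pointwise algebra of the far-field pressure
integrand of ONE explicit compactly supported profile; no flow, stage, schedule or certificate.

By `anchor_test_iff_fderiv3` (p450530) the strict anchor test of the composite `blob + μ P` at the blob's centre `0` (flat, even)
is the POSITIVITY of `∫ D³Γ(0 − x)(μ P x, μ P x, Y₀ e₃) dx`. For the swirling `faintPusher` of record the integrand is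
pointwise `≥ 0` (forward cone, velocities `⊥ e₃`). For a STERILE (poloidal) pusher `P x = α (x₀, x₁, 0) + β e₃` it is NOT:
with `s = x₀² + x₁²` (`fderiv3_newtonKernel_apply`, p449691)

  `D³Γ(−x)(P x, P x, e₃) = N / (4π ‖x‖⁷)`, `N = 3x₂ s (x₂² − 4s) α² + 6 s (s − 4x₂²) α β + 3x₂ (3s − 2x₂²) β²`,

an indefinite form in `(α, β)` at every point. On the shell `{s ≤ 3/4, 9/2 ≤ x₂ ≤ 11/2}` carrying `ringPusher δ` we prove the
sum-of-squares bound `N ≥ 100 s α² − 2100 β²` (`quadForm_lower`), hence (denominator between `4π (9/2)⁷` and `4π (28/5)⁷`)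
**`ringEnvelope_le_ringDensity`**: `D³Γ(−x)(P x, P x, e₃) ≥ c_lo s α² − c_hi β²` pointwise, and
**`fderiv3_ringPusher_eq`**: the nested-`fderiv` integrand of `anchor_test_iff_fderiv3` for `(μ • ringPusher δ, c • e₃)` IS
`μ² c · ringDensity δ` at every point. The integration (cylindrical separation, pancake scaling, the sign) is the sequel
`PalasekTowerRingPusherSign`.

References: D. Gilbarg, N. S. Trudinger, *Elliptic PDE of Second Order* (2001), (2.13) [cite: GilbargTrudinger2001, (2.13)];
A. J. Majda, A. L. Bertozzi (CUP 2002) §1.8 Prop. 1.16 [cite: MajdaBertozziCUP2002, §1.8 Prop. 1.16].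
-/

noncomputable section

namespace Summit.NavierStokesRegularity.FluidComputer.PalasekTowerClayBridge.Germ

open Set Function Filter Topology InnerProductSpace Metric MeasureTheory Real
open scoped Topology ContDiff RealInnerProductSpace

open Literature.Analysis.FluidPDE TinyBlob

-- nested operator types `ℝ³ →L[ℝ] ℝ³ →L[ℝ] ℝ` (third derivatives of the Newtonian kernel)
set_option maxSynthPendingDepth 3

/-! ## §0 More on the two profiles -/

/-- `f′` is continuous. [folklore] -/
theorem continuous_deriv_ringRad : Continuous (deriv ringRad) := contDiff_ringRad.continuous_deriv (by simp)

/-- `η′` is continuous. [folklore] -/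
theorem continuous_deriv_ringAx : Continuous (deriv ringAx) := contDiff_ringAx.continuous_deriv (by simp)

/-- `f = 1` on `[3/8, 5/8]`. [folklore] -/
theorem ringRad_eq_one {σ : ℝ} (h₁ : 3 / 8 ≤ σ) (h₂ : σ ≤ 5 / 8) : ringRad σ = 1 := by
  refine ringRadBump.one_of_mem_closedBall ?_
  rw [mem_closedBall, Real.dist_eq, abs_le]
  exact ⟨by show -(1 / 8 : ℝ) ≤ σ - 1 / 2; linarith, by show σ - 1 / 2 ≤ (1 / 8 : ℝ); linarith⟩

/-- `η = 1` on `[−1, 1]`. [folklore] -/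
theorem ringAx_eq_one {t : ℝ} (h : |t| ≤ 1) : ringAx t = 1 := by
  refine ringAxBump.one_of_mem_closedBall ?_
  rw [mem_closedBall, Real.dist_eq, sub_zero]
  exact h

/-- `η′` is not identically zero (`η(0) = 1 ≠ 0 = η(3)`). [folklore] -/
theorem exists_deriv_ringAx_ne_zero : ∃ t, deriv ringAx t ≠ 0 := by
  by_contra h
  push Not at h
  have hconst := is_const_of_deriv_eq_zero differentiable_ringAx h 0 3
  have h0 : ringAx 0 = 1 := ringAx_eq_one (by norm_num)
  have h3 : ringAx 3 = 0 := (ringAx_and_deriv_eq_zero (t := 3) (by norm_num)).1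
  rw [h0, h3] at hconst
  exact one_ne_zero hconst

/-- `η′` has compact support, hence so has `(η′)²`. [folklore] -/
theorem hasCompactSupport_deriv_ringAx_sq : HasCompactSupport fun t => deriv ringAx t ^ 2 := by
  have h : HasCompactSupport (deriv ringAx) := ringAxBump.hasCompactSupport.deriv
  have hfun : (fun t => deriv ringAx t ^ 2) = deriv ringAx * deriv ringAx := by funext t; simp [sq]
  rw [hfun]
  exact h.mul_right

/-- `η²` has compact support. [folklore] -/
theorem hasCompactSupport_ringAx_sq : HasCompactSupport fun t => ringAx t ^ 2 := by
  have h : HasCompactSupport ringAx := ringAxBump.hasCompactSupport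
  have hfun : (fun t => ringAx t ^ 2) = ringAx * ringAx := by funext t; simp [sq]
  rw [hfun]
  exact h.mul_right

/-! ## §1 The quadratic form and its lower envelope on the shell -/

/-- **SUM-OF-SQUARES BOUND**: on `0 ≤ s ≤ 3/4`, `9/2 ≤ x₂ ≤ 11/2`,
`3x₂ s (x₂² − 4s) α² + 6 s (s − 4x₂²) α β + 3x₂ (3s − 2x₂²) β² ≥ 100 s α² − 2100 β²`. [folklore] -/
theorem quadForm_lower {s z α β : ℝ} (hs0 : 0 ≤ s) (hs : s ≤ 3 / 4) (hz1 : 9 / 2 ≤ z) (hz2 : z ≤ 11 / 2) :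
    100 * (s * α ^ 2) - 2100 * β ^ 2 ≤
      3 * z * s * (z ^ 2 - 4 * s) * α ^ 2 + 6 * s * (s - 4 * z ^ 2) * α * β + 3 * z * (3 * s - 2 * z ^ 2) * β ^ 2 := by
  set b : ℝ := 6 * (s - 4 * z ^ 2) with hb
  -- the three nonnegative pieces
  have hT1 : 0 ≤ 3 * z * (z ^ 2 - 4 * s) - 200 := by nlinarith
  have hz2sq : z ^ 2 ≤ 121 / 4 := by nlinarith
  have hbabs : b ^ 2 ≤ 36 * (4 * z ^ 2) ^ 2 := by
    have h1 : 0 ≤ 4 * z ^ 2 - s := by nlinarith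
    have h2 : 4 * z ^ 2 - s ≤ 4 * z ^ 2 := by linarith
    have : (s - 4 * z ^ 2) ^ 2 ≤ (4 * z ^ 2) ^ 2 := by nlinarith
    rw [hb]; nlinarith
  have hz4 : (4 * z ^ 2) ^ 2 ≤ 121 ^ 2 := by nlinarith
  have hb2 : s * b ^ 2 / 400 ≤ 990 := by
    rw [div_le_iff₀ (by norm_num : (0 : ℝ) < 400)]
    have : s * b ^ 2 ≤ 3 / 4 * (36 * 121 ^ 2) := by
      calc s * b ^ 2 ≤ 3 / 4 * b ^ 2 := by nlinarith [sq_nonneg b]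
        _ ≤ 3 / 4 * (36 * (4 * z ^ 2) ^ 2) := by nlinarith
        _ ≤ 3 / 4 * (36 * 121 ^ 2) := by nlinarith
    linarith
  have hC : -999 ≤ 3 * z * (3 * s - 2 * z ^ 2) := by
    have hz3 : z ^ 3 ≤ (11 / 2) ^ 3 := by
      exact pow_le_pow_left₀ (by linarith) hz2 3
    nlinarith
  have hT3 : 0 ≤ 2100 + 3 * z * (3 * s - 2 * z ^ 2) - s * b ^ 2 / 400 := by linarith
  have key : 3 * z * s * (z ^ 2 - 4 * s) * α ^ 2 + 6 * s * (s - 4 * z ^ 2) * α * β +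
      3 * z * (3 * s - 2 * z ^ 2) * β ^ 2 - (100 * (s * α ^ 2) - 2100 * β ^ 2) =
      (3 * z * (z ^ 2 - 4 * s) - 200) * (s * α ^ 2) + s * (10 * α + b * β / 20) ^ 2 +
        (2100 + 3 * z * (3 * s - 2 * z ^ 2) - s * b ^ 2 / 400) * β ^ 2 := by
    rw [hb]; ring
  nlinarith [key, mul_nonneg hT1 (mul_nonneg hs0 (sq_nonneg α)), mul_nonneg hs0 (sq_nonneg (10 * α + b * β / 20)),
    mul_nonneg hT3 (sq_nonneg β)]

/-- Division by a denominator in `[D₁, D₂]`, `D₁ > 0`: `N ≥ 100A − 2100B`, `A, B ≥ 0` ⟹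
`N/D ≥ (100/D₂) A − (2100/D₁) B`. [folklore] -/
theorem div_lower {N A B D D₁ D₂ : ℝ} (hD₁ : 0 < D₁) (h1 : D₁ ≤ D) (h2 : D ≤ D₂) (hA : 0 ≤ A) (hB : 0 ≤ B)
    (hN : 100 * A - 2100 * B ≤ N) : 100 / D₂ * A - 2100 / D₁ * B ≤ N / D := by
  have hD : 0 < D := lt_of_lt_of_le hD₁ h1
  have hD₂ : 0 < D₂ := lt_of_lt_of_le hD h2
  rw [le_div_iff₀ hD]
  have e1 : 100 / D₂ * A * D ≤ 100 * A := by
    rw [div_mul_eq_mul_div, div_mul_eq_mul_div, div_le_iff₀ hD₂]; nlinarith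
  have e2 : 2100 * B ≤ 2100 / D₁ * B * D := by
    rw [div_mul_eq_mul_div, div_mul_eq_mul_div, le_div_iff₀ hD₁]; nlinarith
  nlinarith

/-- The lower constant `c_lo = 100 / (4π (28/5)⁷)`. [folklore] -/
def ringCLo : ℝ := 100 / (4 * π * (28 / 5) ^ 7)

/-- The upper constant `c_hi = 2100 / (4π (9/2)⁷)`. [folklore] -/
def ringCHi : ℝ := 2100 / (4 * π * (9 / 2) ^ 7)

/-- `c_lo > 0`. [folklore] -/
theorem ringCLo_pos : 0 < ringCLo := by unfold ringCLo; positivity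

/-- `c_hi > 0`. [folklore] -/
theorem ringCHi_pos : 0 < ringCHi := by unfold ringCHi; positivity

/-! ## §2 The explicit integrand of the ring pusher and its lower envelope -/

/-- **The explicit integrand** `N(x) / (4π max(‖x‖, 1)⁷)` (`= D³Γ(−x)(P x, P x, e₃)`; the `max` only makes the
expression continuous at the origin, where `P = 0` anyway). [folklore] -/
def ringDensity (δ : ℝ) (x : EuclideanSpace ℝ (Fin 3)) : ℝ :=
  (3 * x 2 * hsq x * (x 2 ^ 2 - 4 * hsq x) * ringAlpha δ x ^ 2 +
      6 * hsq x * (hsq x - 4 * x 2 ^ 2) * ringAlpha δ x * ringBeta δ x +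
        3 * x 2 * (3 * hsq x - 2 * x 2 ^ 2) * ringBeta δ x ^ 2) /
    (4 * π * max ‖x‖ 1 ^ 7)

/-- **The lower envelope** `c_lo s α² − c_hi β²`. [folklore] -/
def ringEnvelope (δ : ℝ) (x : EuclideanSpace ℝ (Fin 3)) : ℝ :=
  ringCLo * (hsq x * ringAlpha δ x ^ 2) - ringCHi * ringBeta δ x ^ 2

/-- `α_δ` and `β_δ` are continuous. [folklore] -/
theorem continuous_ringAlpha_ringBeta (δ : ℝ) : Continuous (ringAlpha δ) ∧ Continuous (ringBeta δ) := by
  have hs := contDiff_hsq.continuous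
  have h2 : Continuous fun x : EuclideanSpace ℝ (Fin 3) => (x 2 - 5) / δ :=
    (((EuclideanSpace.proj (2 : Fin 3) : EuclideanSpace ℝ (Fin 3) →L[ℝ] ℝ).continuous).sub continuous_const).div_const _
  refine ⟨?_, ?_⟩
  · unfold ringAlpha
    exact ((contDiff_ringRad.continuous.comp hs).mul (continuous_deriv_ringAx.comp h2)).div_const _ |>.neg
  · unfold ringBeta
    exact (continuous_const.mul ((contDiff_ringRad.continuous.comp hs).add
      (hs.mul (continuous_deriv_ringRad.comp hs)))).mul (contDiff_ringAx.continuous.comp h2)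

/-- The explicit integrand is continuous. [folklore] -/
theorem continuous_ringDensity (δ : ℝ) : Continuous (ringDensity δ) := by
  obtain ⟨ha, hb⟩ := continuous_ringAlpha_ringBeta δ
  have hs := contDiff_hsq.continuous
  have h2 : Continuous fun x : EuclideanSpace ℝ (Fin 3) => x 2 :=
    (EuclideanSpace.proj (2 : Fin 3) : EuclideanSpace ℝ (Fin 3) →L[ℝ] ℝ).continuous
  have hden : Continuous fun x : EuclideanSpace ℝ (Fin 3) => 4 * π * max ‖x‖ 1 ^ 7 :=
    continuous_const.mul ((continuous_norm.max continuous_const).pow 7)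
  have hden0 : ∀ x : EuclideanSpace ℝ (Fin 3), 4 * π * max ‖x‖ 1 ^ 7 ≠ 0 := fun x => by
    have : 0 < max ‖x‖ 1 := lt_of_lt_of_le one_pos (le_max_right _ _)
    positivity
  unfold ringDensity
  exact Continuous.div (by fun_prop) hden hden0

/-- The lower envelope is continuous. [folklore] -/
theorem continuous_ringEnvelope (δ : ℝ) : Continuous (ringEnvelope δ) := by
  obtain ⟨ha, hb⟩ := continuous_ringAlpha_ringBeta δ
  have hs := contDiff_hsq.continuous
  unfold ringEnvelope
  fun_prop

section Pointwise

variable {δ : ℝ} (hδ : 0 < δ) (hδ4 : δ ≤ 1 / 4)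
include hδ hδ4

/-- Off the shell region both vanish. [folklore] -/
theorem ringDensity_ringEnvelope_eq_zero {x : EuclideanSpace ℝ (Fin 3)} (hx : x ∉ ringRegion) :
    ringDensity δ x = 0 ∧ ringEnvelope δ x = 0 := by
  obtain ⟨ha, hb⟩ := ringAlpha_ringBeta_eq_zero hδ hδ4 hx
  simp [ringDensity, ringEnvelope, ha, hb]

/-- Both have compact support (inside `B̄(0, 7)`). [folklore] -/
theorem hasCompactSupport_ringDensity_ringEnvelope :
    HasCompactSupport (ringDensity δ) ∧ HasCompactSupport (ringEnvelope δ) := by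
  have hK : IsCompact (closedBall (0 : EuclideanSpace ℝ (Fin 3)) 7) := isCompact_closedBall _ _
  have hout : ∀ x : EuclideanSpace ℝ (Fin 3), x ∉ closedBall (0 : EuclideanSpace ℝ (Fin 3)) 7 → x ∉ ringRegion :=
    fun x hx hR => hx (by
      rw [mem_closedBall, dist_zero_right]; linarith [(norm_bounds_of_mem_ringRegion hR).2])
  exact ⟨HasCompactSupport.intro hK fun x hx => (ringDensity_ringEnvelope_eq_zero hδ hδ4 (hout x hx)).1,
    HasCompactSupport.intro hK fun x hx => (ringDensity_ringEnvelope_eq_zero hδ hδ4 (hout x hx)).2⟩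

/-- **THE POINTWISE LOWER BOUND** `ringEnvelope δ ≤ ringDensity δ`. [folklore] -/
theorem ringEnvelope_le_ringDensity (x : EuclideanSpace ℝ (Fin 3)) : ringEnvelope δ x ≤ ringDensity δ x := by
  by_cases hx : x ∈ ringRegion
  · obtain ⟨hs, h1, h2⟩ := hx
    obtain ⟨hn1, hn2⟩ := norm_bounds_of_mem_ringRegion ⟨hs, h1, h2⟩
    have hmax : max ‖x‖ 1 = ‖x‖ := max_eq_left (by linarith)
    have hN := quadForm_lower (α := ringAlpha δ x) (β := ringBeta δ x) (hsq_nonneg x) hs h1 h2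
    have hD1 : 4 * π * (9 / 2) ^ 7 ≤ 4 * π * ‖x‖ ^ 7 := by
      have := pow_le_pow_left₀ (by norm_num) hn1 7
      nlinarith [pi_pos]
    have hD2 : 4 * π * ‖x‖ ^ 7 ≤ 4 * π * (28 / 5) ^ 7 := by
      have := pow_le_pow_left₀ (norm_nonneg x) hn2 7
      nlinarith [pi_pos]
    have h := div_lower (D := 4 * π * ‖x‖ ^ 7) (by positivity) hD1 hD2
      (mul_nonneg (hsq_nonneg x) (sq_nonneg (ringAlpha δ x))) (sq_nonneg (ringBeta δ x)) hN
    rw [ringDensity, hmax, ringEnvelope, ringCLo, ringCHi]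
    exact h
  · obtain ⟨h1, h2⟩ := ringDensity_ringEnvelope_eq_zero hδ hδ4 hx
    rw [h1, h2]

/-- **THE INTEGRAND OF THE ANCHOR TEST IS THE EXPLICIT DENSITY**: for `μ, c ∈ ℝ`,
`D³Γ(0 − x)((μP) x, (μP) x, c e₃) = μ² c · ringDensity δ x` at every point. [cite: GilbargTrudinger2001, (2.13)] -/
theorem fderiv3_ringPusher_eq (μ c : ℝ) (x : EuclideanSpace ℝ (Fin 3)) :
    fderiv ℝ (fun w => fderiv ℝ (fun w' => fderiv ℝ newtonKernel w' ((μ • ringPusher δ) x)) w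
      ((μ • ringPusher δ) x)) (0 - x) (c • e₃) = μ ^ 2 * c * ringDensity δ x := by
  by_cases hx : x ∈ ringRegion
  · have hn := (norm_bounds_of_mem_ringRegion hx).1
    have hx0 : x ≠ 0 := by
      intro h; rw [h, norm_zero] at hn; linarith
    have hz : (0 : EuclideanSpace ℝ (Fin 3)) - x ≠ 0 := by rwa [zero_sub, neg_ne_zero]
    have hmax : max ‖x‖ 1 = ‖x‖ := max_eq_left (by linarith)
    have hnx : ‖x‖ ≠ 0 := norm_ne_zero_iff.2 hx0
    have hza : ⟪(0 : EuclideanSpace ℝ (Fin 3)) - x, μ • ringPusher δ x⟫ =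
        -(μ * (ringAlpha δ x * hsq x + ringBeta δ x * x 2)) := by
      rw [zero_sub, inner_neg_left, inner_smul_right, inner_self_ringPusher]
    have hzc : ⟪(0 : EuclideanSpace ℝ (Fin 3)) - x, c • e₃⟫ = -(c * x 2) := by
      rw [zero_sub, inner_neg_left, inner_smul_right, inner_e₃_right]
    have hnz : ‖(0 : EuclideanSpace ℝ (Fin 3)) - x‖ = ‖x‖ := by rw [zero_sub, norm_neg]
    have hab : ⟪μ • ringPusher δ x, μ • ringPusher δ x⟫ = μ ^ 2 * (hsq x * ringAlpha δ x ^ 2 + ringBeta δ x ^ 2) := by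
      rw [real_inner_self_eq_norm_sq, norm_smul, mul_pow, Real.norm_eq_abs, sq_abs, norm_ringPusher_sq]
    have hac : ⟪μ • ringPusher δ x, c • e₃⟫ = μ * c * ringBeta δ x := by
      rw [real_inner_smul_left, inner_smul_right, inner_ringPusher_e₃]; ring
    rw [Pi.smul_apply, fderiv3_newtonKernel_apply hz, hza, hzc, hnz, hab, hac, ringDensity, hmax,
      norm_sq_eq_hsq_add]
    field_simp
    ring
  · have hP : ringPusher δ x = 0 := ringPusher_eq_zero_of_notMem hδ hδ4 hx
    have h0 : ringDensity δ x = 0 := (ringDensity_ringEnvelope_eq_zero hδ hδ4 hx).1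
    rw [h0, Pi.smul_apply, hP, smul_zero]
    simp

end Pointwise

end Summit.NavierStokesRegularity.FluidComputer.PalasekTowerClayBridge.Germ

end
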